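import Literature.Computability.QuantumComplexity.PolynomialMethod
import Literature.Computability.QuantumComplexity.Symmetrization
import Literature.Computability.QuantumComplexity.ExactQuantumQuery
import Literature.Computability.Complexity.BlockSensitivity
import Literature.Analysis.Approximation.EhlichZeller
import HarnessLib

/-!
# Block sensitivity lower-bounds quantum query complexity: `bs(f) ≤ 16 Q₂(f)²`

Beals–Buhrman–Cleve–Mosca–de Wolf, *Quantum lower bounds by polynomials*, J. ACM 48 (2001),
**Theorem 4.13**: "If `f` is a Boolean function, then `Q_E(f) ≥ √(bs(f)/8)` and
`Q₂(f) ≥ √(bs(f)/16)`." We prove the bounded-error half in the squared form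
`bs(f) ≤ 16 · Q₂(f)²` (`blockSensitivity_le_sixteen_mul_sq`), for the tree's measures
`Literature.Computability.Complexity.blockSensitivity` (`BlockSensitivity.lean`, Def. 4.11) and
`Literature.Computability.Cryptography.quantumQueryComplexity (1/3)` (`QuantumQuery.lean`).
This is the ingredient `bs(f) = O(Q(f)²)` of Aaronson–Ben-David–Kothari–Rao–Tal's
`D(f) = O(Q(f)⁴)` (STOC 2021, proof of Thm. 1).

**The printed proof** (p. 9 of arXiv:quant-ph/9802049) and its tree counterparts.
"Consider a network using `T = Q₂(f)` queries that computes `f` with error probability `≤ 1/3`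
(`exists_queries_eq_quantumQueryComplexityOn`). Let `P` be the polynomial of degree `≤ 2T` that
approximates `f` … `P(X) ∈ [0,1]` for all `X ∈ {0,1}ᴺ`" (`exists_polynomial_of_computesWithError`,
`PolynomialMethod.lean`). "Let `b = bs(f)`, and `X` and `B₀,…,B_{b-1}` be the input and sets which
achieve the block sensitivity (`exists_blocks_of_blockSensitivity`). We assume without loss of
generality that `f(X) = 0` (otherwise replace `P` by `1 - P`). … Define `Z … z_j = y_i` if
`x_j = 0` and `j ∈ B_i`, `z_j = 1 - y_i` if `x_j = 1` and `j ∈ B_i`, and `z_j = x_j` if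
`j ∉ B_i`" (`blockSubst`, `eval_blockSubst`). "Now `q(Y) = P(Z)` is a `b`-variate polynomial of
degree `≤ 2T` (`totalDegree_bind₁_le_of_le_one`) such that `q(Y) ∈ [0,1]`, `0 ≤ q(0) ≤ 1/3`,
`2/3 ≤ q(Y) ≤ 1` if `|Y| = 1`. Let `r` be the single-variate polynomial of degree `≤ 2T` obtained
from symmetrizing `q` (`symPoly`, `choose_mul_symPoly_eval`, `Symmetrization.lean`). Note that
`0 ≤ r(i) ≤ 1` for every integer `0 ≤ i ≤ b`, and … `r(0) ≤ 1/3` and `r(1) ≥ 2/3`. Applying the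
previous theorem [Ehlich–Zeller / Rivlin–Cheney, `le_four_mul_natDegree_sq`,
`Literature/Analysis/Approximation/EhlichZeller.lean`] we get `deg(r) ≥ √(b/4)`, hence
`T ≥ √(b/16)`" (`card_le_four_mul_sq_of_approx`, `blockSensitivity_le_sixteen_mul_sq`).

No named facts are introduced; everything is proved. The case `N = 0` (no query algorithm
exists, `Q = 0` by the junk value of `QuantumQuery.lean`) holds because `bs(f) ≤ N`
(`blockSensitivity_le`).

## References

* R. Beals, H. Buhrman, R. Cleve, M. Mosca, R. de Wolf, *Quantum lower bounds by polynomials*,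
  J. ACM 48 (2001) 778–797, Thm. 4.13 with Lemma 3.2, Lemma 4.2, Thm. 4.12
  (arXiv:quant-ph/9802049, p. 9) [BealsEtAl2001].
* S. Aaronson, S. Ben-David, R. Kothari, S. Rao, A. Tal, *Degree vs. approximate degree and
  quantum implications of Huang's sensitivity theorem*, STOC 2021, §1 (proof of Thm. 1:
  "`bs(f) = O(Q(f)²)`") [AaronsonBenDavidKothariRaoTal2021].
-/

namespace Literature.Computability.QuantumComplexity

open MvPolynomial Finset Literature.Computability.Cryptography Literature.Computability.Complexity
  Literature.Analysis.Approximation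

/-! ### `bs(f) ≤ N` -/

/-- A sensitive family has at most `N` blocks (its blocks are nonempty and pairwise disjoint).
[folklore] -/
theorem IsSensitiveFamily.card_le_card {N : ℕ} {f : (Fin N → Bool) → Bool} {x : Fin N → Bool}
    {𝓑 : Finset (Finset (Fin N))} (h : IsSensitiveFamily f x 𝓑) : 𝓑.card ≤ N := by
  classical
  calc 𝓑.card = ∑ B ∈ 𝓑, 1 := by simp
    _ ≤ ∑ B ∈ 𝓑, (id B).card :=
        Finset.sum_le_sum fun B hB => Finset.one_le_card.mpr (h.1 B hB).nonempty
    _ = (𝓑.biUnion id).card := (Finset.card_biUnion h.2).symm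
    _ ≤ (Finset.univ : Finset (Fin N)).card := Finset.card_le_card (Finset.subset_univ _)
    _ = N := by simp

/-- `bs(f) ≤ N`. [cite: BealsEtAl2001, Def 4.11] -/
theorem blockSensitivity_le {N : ℕ} (f : (Fin N → Bool) → Bool) : blockSensitivity f ≤ N := by
  classical
  refine Finset.sup_le fun x _ => Finset.sup_le fun 𝓑 h𝓑 => ?_
  exact IsSensitiveFamily.card_le_card (by simpa using h𝓑)

/-- `bs(f)` is attained: some input carries `bs(f)` pairwise disjoint sensitive blocks, which we
index by `Fin (bs f)` ("let `b = bs(f)`, and `X` and `B₀, …, B_{b-1}` be the input and sets which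
achieve the block sensitivity"). [cite: BealsEtAl2001, Thm 4.13 (proof)] -/
theorem exists_blocks_of_blockSensitivity {N : ℕ} (f : (Fin N → Bool) → Bool) :
    ∃ (x : Fin N → Bool) (B : Fin (blockSensitivity f) → Finset (Fin N)),
      (∀ j, f (flipBlock x (B j)) ≠ f x) ∧ ∀ j j', j ≠ j' → Disjoint (B j) (B j') := by
  classical
  obtain ⟨x, -, hx⟩ := Finset.exists_mem_eq_sup (Finset.univ : Finset (Fin N → Bool))
    Finset.univ_nonempty (blockSensitivityAt f)
  obtain ⟨𝓑, h𝓑, hcard⟩ := exists_family_card_eq f x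
  have hc : 𝓑.card = blockSensitivity f := by rw [hcard, blockSensitivity, hx]
  let e : Fin (blockSensitivity f) ≃ {B // B ∈ 𝓑} := (𝓑.equivFinOfCardEq hc).symm
  refine ⟨x, fun j => (e j).1, fun j => h𝓑.1 _ (e j).2, fun j j' hjj' => ?_⟩
  have hne : (e j).1 ≠ (e j').1 := fun h => hjj' (e.injective (Subtype.ext h))
  exact h𝓑.2 (e j).2 (e j').2 hne

/-! ### Substituting block variables (the polynomial `q(Y) = P(Z)`) -/

section Subst

variable {N b : ℕ}

/-- The substitution `Z(Y)` of Beals et al.: variable `x_i` becomes `y_j` if `i ∈ B_j` and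
`x_i = 0`, `1 - y_j` if `i ∈ B_j` and `x_i = 1`, and the constant `x_i` if `i` lies in no block;
written as the affine form `[x_i] + ∑_j [i ∈ B_j] · (1 - 2[x_i]) · y_j` (at most one summand is
nonzero when the blocks are disjoint). [cite: BealsEtAl2001, Thm 4.13 (proof)] -/
noncomputable def blockSubst (x : Fin N → Bool) (B : Fin b → Finset (Fin N)) (i : Fin N) :
    MvPolynomial (Fin b) ℝ :=
  C (if x i then 1 else 0) + ∑ j, if i ∈ B j then C (if x i then -1 else 1) * X j else 0

/-- Each substituted coordinate is an affine form (total degree `≤ 1`). [folklore] -/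
theorem totalDegree_blockSubst_le (x : Fin N → Bool) (B : Fin b → Finset (Fin N)) (i : Fin N) :
    (blockSubst x B i).totalDegree ≤ 1 := by
  unfold blockSubst
  refine (totalDegree_add _ _).trans (max_le ?_ ?_)
  · rw [totalDegree_C]; exact Nat.zero_le _
  refine (totalDegree_finsetSum _ _).trans (Finset.sup_le fun j _ => ?_)
  by_cases h : i ∈ B j
  · rw [if_pos h]
    refine (totalDegree_mul _ _).trans ?_
    rw [totalDegree_C, zero_add, totalDegree_X]
  · rw [if_neg h, totalDegree_zero]; exact Nat.zero_le _

/-- Substituting affine forms does not raise the total degree ("`q(Y) = P(Z)` is a `b`-variate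
polynomial of degree `≤ 2T`"). [folklore] -/
theorem totalDegree_bind₁_le_of_le_one {σ τ : Type*} (φ : σ → MvPolynomial τ ℝ)
    (hφ : ∀ i, (φ i).totalDegree ≤ 1) (F : MvPolynomial σ ℝ) :
    (bind₁ φ F).totalDegree ≤ F.totalDegree := by
  classical
  conv_lhs => rw [F.as_sum]
  rw [map_sum]
  refine (totalDegree_finsetSum _ _).trans (Finset.sup_le fun e he => ?_)
  rw [bind₁_monomial]
  refine (totalDegree_mul _ _).trans ?_
  rw [totalDegree_C, zero_add]
  refine (totalDegree_finsetProd _ _).trans ?_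
  refine le_trans (Finset.sum_le_sum fun i _ => (totalDegree_pow _ _).trans
    (Nat.mul_le_mul_left _ (hφ i))) ?_
  simp only [mul_one]
  exact le_totalDegree he

/-- The set of positions flipped by the block assignment `y`: the union of the blocks `B_j` with
`y_j = 1`. [cite: BealsEtAl2001, Thm 4.13 (proof)] -/
def flippedSet (B : Fin b → Finset (Fin N)) (y : Fin b → Bool) : Finset (Fin N) :=
  (Finset.univ.filter fun j => y j = true).biUnion B

/-- Membership in `flippedSet`. [folklore] -/
theorem mem_flippedSet {B : Fin b → Finset (Fin N)} {y : Fin b → Bool} {i : Fin N} :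
    i ∈ flippedSet B y ↔ ∃ j, y j = true ∧ i ∈ B j := by
  simp [flippedSet]

/-- `Z(Y)` at a Boolean `Y` is the Boolean point `X^{∪_{y_j = 1} B_j}` ("if `Y = 0` then `Z = X`,
and if `Y` has `y_i = 1` and `y_j = 0` for `j ≠ i` then `Z = X^{B_i}`"), for pairwise disjoint
blocks. [cite: BealsEtAl2001, Thm 4.13 (proof)] -/
theorem eval_blockSubst (x : Fin N → Bool) {B : Fin b → Finset (Fin N)}
    (hB : ∀ j j', j ≠ j' → Disjoint (B j) (B j')) (y : Fin b → Bool) (i : Fin N) :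
    MvPolynomial.eval (Multilinear.boolPt (R := ℝ) y) (blockSubst x B i) =
      Multilinear.boolPt (R := ℝ) (flipBlock x (flippedSet B y)) i := by
  unfold blockSubst
  simp only [map_add, map_sum, eval_C, Multilinear.boolPt_apply]
  by_cases hi : ∃ j, i ∈ B j
  · obtain ⟨j, hj⟩ := hi
    rw [Finset.sum_eq_single j]
    · rw [if_pos hj, map_mul, eval_C, eval_X, Multilinear.boolPt_apply]
      by_cases hy : y j = true
      · have hmem : i ∈ flippedSet B y := mem_flippedSet.mpr ⟨j, hy, hj⟩
        rw [flipBlock_apply_of_mem hmem, if_pos hy]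
        cases x i <;> simp
      · have hmem : i ∉ flippedSet B y := by
          intro h
          obtain ⟨j', hj', hij'⟩ := mem_flippedSet.mp h
          have : j' = j := by
            by_contra hne
            exact Finset.disjoint_left.mp (hB j' j hne) hij' hj
          exact hy (this ▸ hj')
        rw [flipBlock_apply_of_not_mem hmem, if_neg hy]
        simp
    · intro j' _ hne
      have hij' : i ∉ B j' := fun hij' => Finset.disjoint_left.mp (hB j' j hne) hij' hj
      rw [if_neg hij', map_zero]
    · simp
  · push Not at hi
    have hmem : i ∉ flippedSet B y := fun h => by
      obtain ⟨j, -, hj⟩ := mem_flippedSet.mp h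
      exact hi j hj
    rw [flipBlock_apply_of_not_mem hmem,
      Finset.sum_eq_zero fun j _ => by rw [if_neg (hi j), map_zero]]
    simp

/-- `q(Y) = P(Z(Y)) = P(X^{∪_{y_j=1} B_j})` on Boolean `Y`. [cite: BealsEtAl2001, Thm 4.13 (proof)] -/
theorem eval_bind₁_blockSubst (x : Fin N → Bool) {B : Fin b → Finset (Fin N)}
    (hB : ∀ j j', j ≠ j' → Disjoint (B j) (B j')) (P : MvPolynomial (Fin N) ℝ)
    (y : Fin b → Bool) :
    MvPolynomial.eval (Multilinear.boolPt (R := ℝ) y) (bind₁ (blockSubst x B) P) =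
      MvPolynomial.eval (Multilinear.boolPt (R := ℝ) (flipBlock x (flippedSet B y))) P := by
  rw [show MvPolynomial.eval (Multilinear.boolPt (R := ℝ) y) (bind₁ (blockSubst x B) P) =
      MvPolynomial.eval (fun i => MvPolynomial.eval (Multilinear.boolPt (R := ℝ) y)
        (blockSubst x B i)) P from eval₂Hom_bind₁ _ _ _ _]
  have h : (fun i => MvPolynomial.eval (Multilinear.boolPt (R := ℝ) y) (blockSubst x B i)) =
      Multilinear.boolPt (R := ℝ) (flipBlock x (flippedSet B y)) :=
    funext fun i => eval_blockSubst x hB y i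
  rw [h]

/-- The indicator vector of `S ⊆ Fin b` (`Symmetrization.lean`) is the Boolean point of the
characteristic function of `S`. [folklore] -/
theorem indicatorVec_eq_boolPt (S : Finset (Fin b)) :
    indicatorVec S = Multilinear.boolPt (R := ℝ) (fun j => decide (j ∈ S)) := by
  funext k
  simp [indicatorVec, Multilinear.boolPt_apply]

/-- The flipped set of the characteristic function of `S` is `∪_{j ∈ S} B_j`; in particular it is
`∅` for `S = ∅` and `B_j` for `S = {j}`. [folklore] -/
theorem flippedSet_decide (B : Fin b → Finset (Fin N)) (S : Finset (Fin b)) :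
    flippedSet B (fun j => decide (j ∈ S)) = S.biUnion B := by
  unfold flippedSet
  congr 1
  ext j
  simp

end Subst

/-! ### The degree bound (Thm. 4.13, core) -/

/-- **Core of Beals et al. Thm. 4.13.** If a real polynomial `P` of total degree `≤ d` takes
values in `[0,1]` on the Boolean cube, is `≤ 1/3` at `x` and `≥ 2/3` at each `x^{B_j}` for `b ≥ 1`
pairwise disjoint blocks `B₀, …, B_{b-1}`, then `b ≤ 4d²` (symmetrize `q(Y) = P(Z(Y))` and apply
Ehlich–Zeller / Rivlin–Cheney). [cite: BealsEtAl2001, Thm 4.13 (proof)] -/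
theorem card_le_four_mul_sq_of_approx {N b d : ℕ} (x : Fin N → Bool)
    {B : Fin b → Finset (Fin N)} (hB : ∀ j j', j ≠ j' → Disjoint (B j) (B j'))
    (P : MvPolynomial (Fin N) ℝ) (hdeg : P.totalDegree ≤ d)
    (h01 : ∀ z : Fin N → Bool, 0 ≤ MvPolynomial.eval (Multilinear.boolPt (R := ℝ) z) P ∧
      MvPolynomial.eval (Multilinear.boolPt (R := ℝ) z) P ≤ 1)
    (hx : MvPolynomial.eval (Multilinear.boolPt (R := ℝ) x) P ≤ 1 / 3)
    (hflip : ∀ j, 2 / 3 ≤ MvPolynomial.eval (Multilinear.boolPt (R := ℝ) (flipBlock x (B j))) P)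
    (hb : 1 ≤ b) : b ≤ 4 * d ^ 2 := by
  classical
  -- `q(Y) = P(Z(Y))`, of degree `≤ d`
  set q : MvPolynomial (Fin b) ℝ := bind₁ (blockSubst x B) P with hq
  have hqdeg : q.totalDegree ≤ d :=
    (totalDegree_bind₁_le_of_le_one _ (totalDegree_blockSubst_le x B) P).trans hdeg
  have hqS : ∀ S : Finset (Fin b), MvPolynomial.eval (indicatorVec S) q =
      MvPolynomial.eval (Multilinear.boolPt (R := ℝ) (flipBlock x (S.biUnion B))) P := by
    intro S
    rw [indicatorVec_eq_boolPt, hq, eval_bind₁_blockSubst x hB P, flippedSet_decide]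
  -- the symmetrization `r`, of degree `≤ d`
  set r := symPoly b q with hr
  have hrdeg : r.natDegree ≤ d := (natDegree_symPoly_le q).trans hqdeg
  have hsym := choose_mul_symPoly_eval q
  -- `0 ≤ r(i) ≤ 1` on the integers `0 ≤ i ≤ b`
  have hr01 : ∀ i : ℕ, i ≤ b → 0 ≤ r.eval (i : ℝ) ∧ r.eval (i : ℝ) ≤ 1 := by
    intro i hi
    have hpos : (0 : ℝ) < b.choose i := by exact_mod_cast Nat.choose_pos hi
    have hi' := hsym i
    rw [← hr] at hi'
    have hlo : 0 ≤ ∑ S ∈ Finset.univ.powersetCard i, MvPolynomial.eval (indicatorVec S) q :=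
      Finset.sum_nonneg fun S _ => by rw [hqS]; exact (h01 _).1
    have hhi : ∑ S ∈ Finset.univ.powersetCard i, MvPolynomial.eval (indicatorVec S) q ≤
        b.choose i := by
      calc _ ≤ ∑ S ∈ Finset.univ.powersetCard i, (1 : ℝ) :=
            Finset.sum_le_sum fun S _ => by rw [hqS]; exact (h01 _).2
        _ = b.choose i := by simp
    constructor
    · by_contra hneg
      push Not at hneg
      have : (b.choose i : ℝ) * r.eval (i : ℝ) < 0 := mul_neg_of_pos_of_neg hpos hneg
      linarith
    · by_contra hgt
      push Not at hgt
      have : (b.choose i : ℝ) * 1 < (b.choose i : ℝ) * r.eval (i : ℝ) :=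
        mul_lt_mul_of_pos_left hgt hpos
      linarith
  -- `r(0) ≤ 1/3`
  have hr0 : r.eval 0 ≤ 1 / 3 := by
    have h0 := hsym 0
    rw [← hr, Nat.choose_zero_right, Nat.cast_one, one_mul, Nat.cast_zero,
      Finset.powersetCard_zero, Finset.sum_singleton, hqS] at h0
    rw [h0]
    simpa using hx
  -- `r(1) ≥ 2/3`
  have hr1 : 2 / 3 ≤ r.eval 1 := by
    have h1 := hsym 1
    rw [← hr, Nat.choose_one_right, Nat.cast_one, Finset.powersetCard_one, Finset.sum_map] at h1
    simp only [Function.Embedding.coeFn_mk] at h1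
    have hsum : (b : ℝ) * (2 / 3) ≤
        ∑ j ∈ (Finset.univ : Finset (Fin b)),
          MvPolynomial.eval (indicatorVec ({j} : Finset _)) q :=
      calc (b : ℝ) * (2 / 3) = ∑ j ∈ (Finset.univ : Finset (Fin b)), (2 / 3 : ℝ) := by simp
        _ ≤ _ := Finset.sum_le_sum fun j _ => by
            rw [hqS, Finset.singleton_biUnion]
            exact hflip j
    have hb' : (0 : ℝ) < b := by exact_mod_cast hb
    rw [← h1] at hsum
    nlinarith
  -- Ehlich–Zeller / Rivlin–Cheney
  have key := le_four_mul_natDegree_sq hb hr01 hr0 hr1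
  calc b ≤ 4 * r.natDegree ^ 2 := key
    _ ≤ 4 * d ^ 2 := Nat.mul_le_mul_left 4 (Nat.pow_le_pow_left hrdeg 2)

/-! ### Theorem 4.13 -/

/-- **Beals–Buhrman–Cleve–Mosca–de Wolf 2001, Theorem 4.13** (bounded-error half,
"`Q₂(f) ≥ √(bs(f)/16)`", squared): `bs(f) ≤ 16 · Q₂(f)²` for every total Boolean function on `N`
bits, with `Q₂ = quantumQueryComplexity (1/3)`. (For `N = 0` both sides are `0`.)
[cite: BealsEtAl2001, Thm 4.13] -/
theorem blockSensitivity_le_sixteen_mul_sq {N : ℕ} (f : (Fin N → Bool) → Bool) :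
    blockSensitivity f ≤ 16 * quantumQueryComplexity (1 / 3) f ^ 2 := by
  classical
  rcases Nat.eq_zero_or_pos N with rfl | hN
  · have := blockSensitivity_le f
    omega
  haveI : NeZero N := NeZero.of_pos hN
  -- an optimal algorithm and its acceptance polynomial
  obtain ⟨A, hAq, hA⟩ := exists_queries_eq_quantumQueryComplexityOn (N := N)
    (ε := 1 / 3) (by norm_num) Set.univ f
  obtain ⟨P, hPdeg, hP01, hP1, hP0⟩ := exists_polynomial_of_computesWithError hA
  set T := quantumQueryComplexity (1 / 3) f with hT
  have hAq' : A.queries = T := hAq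
  rw [hAq'] at hPdeg
  -- the blocks achieving `bs(f)`
  obtain ⟨x, B, hsens, hdisj⟩ := exists_blocks_of_blockSensitivity f
  rcases Nat.eq_zero_or_pos (blockSensitivity f) with hb0 | hb1
  · rw [hb0]; exact Nat.zero_le _
  -- wlog `f x = 0`: otherwise use `1 - P`
  suffices h : blockSensitivity f ≤ 4 * (2 * T) ^ 2 by
    calc blockSensitivity f ≤ 4 * (2 * T) ^ 2 := h
      _ = 16 * T ^ 2 := by ring
  cases hfx : f x
  · -- `f x = false`: use `P`
    refine card_le_four_mul_sq_of_approx x hdisj P hPdeg hP01 ?_ ?_ hb1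
    · exact hP0 x (Set.mem_univ _) hfx
    · intro j
      have hfj : f (flipBlock x (B j)) = true := by
        have := hsens j; rw [hfx] at this; simpa using this
      linarith [hP1 _ (Set.mem_univ _) hfj]
  · -- `f x = true`: use `1 - P`
    refine card_le_four_mul_sq_of_approx x hdisj (1 - P) ?_ ?_ ?_ ?_ hb1
    · exact (totalDegree_sub _ _).trans (max_le (by simp) hPdeg)
    · intro z
      simp only [map_sub, map_one]
      constructor <;> linarith [(hP01 z).1, (hP01 z).2]
    · simp only [map_sub, map_one]
      linarith [hP1 x (Set.mem_univ _) hfx]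
    · intro j
      have hfj : f (flipBlock x (B j)) = false := by
        have := hsens j; rw [hfx] at this; simpa using this
      simp only [map_sub, map_one]
      linarith [hP0 _ (Set.mem_univ _) hfj]

/-- **Theorem 4.13, real form**: `bs(f) ≤ 16 · Q₂(f)²` with casts to `ℝ` (the form consumed by
the assembly of `D(f) = O(Q₂(f)⁴)`). [cite: BealsEtAl2001, Thm 4.13] -/
theorem blockSensitivity_le_sixteen_mul_sq_real {N : ℕ} (f : (Fin N → Bool) → Bool) :
    (blockSensitivity f : ℝ) ≤ 16 * (quantumQueryComplexity (1 / 3) f : ℝ) ^ 2 := by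
  exact_mod_cast blockSensitivity_le_sixteen_mul_sq f

end Literature.Computability.QuantumComplexity
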